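import Literature.AlgebraicGeometry.AbelianSchemes.PDivisibleGroupBlockHeightTransport
import Literature.AlgebraicGeometry.AbelianSchemes.TorsionSectionTranslationAction
import Literature.AlgebraicGeometry.GroupSchemes.AffineGroupSchemeSpecPoints
import HarnessLib

/-!
# Torsion sections of an abelian scheme over a field = torsion points of the abelian variety, equivariantly
# (Mumford–Fogarty–Kirwan, GIT Ch. 7 §2 Def. 7.1; Görtz–Wedhorn II (27.1.1))

Layer `Literature/AlgebraicGeometry/AbelianSchemes`, namespace `Literature.AlgebraicGeometry.AbelianSchemes.AbelianSchemeOver`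
(+ `RingAction`).  Cell `hodgecm-mathlib` (D-0151), FLOOR 0, P6 «MOD programme», DEAL 9 v2 (S-H-BRIDGE) of the K∕BT cut (F0P6d-plan (g2)
2026-09-01T19:48:49Z): the bridge between the K∕BT currency of socket (S-H) — sections `𝟙 ⟶ A[N]` of the finite group scheme `A[N]`
fixed by `u[N]` (★ `PDivisibleGroupBlockHeightTransport` §4 `hcount`) — and the A-lane (Betti ∕ Tate) currency — `N`-torsion POINTS
`P ∈ A(Ω)` of the abelian VARIETY `A` fixed by `u` (GEN (S-H-A), `Motives.AbelianVariety.torsionPoints`).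
`--supports stmt-HodgeConjecture-24832`; COUNT-NEUTRAL — HC_CM is proved only modulo the 2 remaining named inputs (hLiu418 24832, h413 24833)
until rung 0 closes; this file discharges none of them.  THEOREMS ONLY (no definition, no instance, no named fact, no `sorry`).

For an abelian scheme `A` over a base `S` with commutative group law, an endomorphism `u` (a homomorphism) and `N : ℕ`:
* §1 (any base, any test scheme `T`) `natCard_fixedPoints_torsion_eq_natCard_fixedPoints_hom` — `T`-valued points `x` of `A[N] = Ker [N]`
  with `x ≫ u[N] = x` ↔ `T`-valued points `t` of `A` with `t ^ N = 1` and `t ≫ u = t` (universal property of the kernel, ★ `torsionLift`,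
  ★ `torsionMap_ι`); for `T = 𝟙_`: `natCard_fixedPoints_torsion_eq_natCard_fixedPoints_torsionSections` (★ `torsionSections`).
* §2 (base a field `Ω`) `natCard_fixedPoints_torsionSections_eq_natCard_fixedPoints_torsionPoints` — sections `𝟙_ ⟶ A` ↔ `Ω`-points
  `specOver Ω Ω ⟶ A` of the abelian variety `A.toAffine.toAbelianVariety` (precomposition with `toUnit (specOver Ω Ω)`, an isomorphism:
  ★ `AffineGroupScheme.unitIsoSpecOver`), `N`-torsion ↔ `torsionPoints Ω N`, `σ ≫ u = σ` ↔ `IsMonHom.monoidHom u (specOver Ω Ω) P = P`.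
* §3 HEAD **`natCard_fixedPoints_torsion_eq_natCard_fixedPoints_torsionPoints`** = §1 ∘ §2, and its reading for the `w`-block data of
  ★ `PDivisibleGroupBlockHeightTransport`: **`RingAction.hrank_specialFibre_of_natCard_fixedPoints_torsionPoints`** — the socket (S-H)
  `hrank` on the special fibre from the count of `ι_Ω(aₙ)`-fixed `pⁿ`-torsion POINTS of the abelian variety `𝒜_Ω` (`Ω = Ω̄`, `(p : Ω) ≠ 0`).

## References
* [MumfordFogartyKirwan1994] D. Mumford, J. Fogarty, F. Kirwan, *Geometric Invariant Theory*, 3rd ed. — Ch. 7 §2 Definition 7.1 (p. 129).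
* [GortzWedhorn2023] U. Görtz, T. Wedhorn, *Algebraic Geometry II* (2023) — (27.1.1), Prop. 27.188 (1).
* [Tate1967] J. T. Tate, *p-divisible groups* — §2 (2.1), (2.4).
-/

noncomputable section

-- `A.toAffine.toAbelianVariety.X = A.X`, `A.mulN N = (𝟙 A.X) ^ N` are definitional only above `instances` transparency.
set_option backward.isDefEq.respectTransparency false

universe u v

open CategoryTheory CategoryTheory.Limits AlgebraicGeometry MonoidalCategory CartesianMonoidalCategory
open scoped MonObj CategoryTheory.Obj

namespace Literature.AlgebraicGeometry.AbelianSchemes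

namespace AbelianSchemeOver

open Literature.AlgebraicGeometry.GroupSchemes Literature.AlgebraicGeometry.GroupSchemes.BTGroup.Hom
open Literature.AlgebraicGeometry.GroupSchemes.IsRingActionBT Literature.AlgebraicGeometry.Motives

/-! ## §1 Points of `A[N]` fixed by `u[N]` = `N`-torsion points of `A` fixed by `u` (any base, any test scheme) -/

section AnyBase

variable {S : Scheme.{u}} (A : AbelianSchemeOver S) [IsCommMonObj A.X] (u : A.X ⟶ A.X) [IsMonHom u] (N : ℕ)

/-- **`T`-valued points of `A[N]` fixed by `u[N]` ↔ `T`-valued points `t` of `A` with `t ^ N = 1` fixed by `u`**, as an equality of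
cardinalities: `x ↦ x ≫ ι` (`(x ≫ ι)^N = x ≫ ι ≫ [N] = 1`, ★ `comp_mulN`, ★ `torsionι_comp_mulN`; inverse ★ `torsionLift`; `u[N] ≫ ι = ι ≫ u`,
★ `torsionMap_ι`, `ι` mono). [cite: GortzWedhorn2023, (27.1.1) and Prop. 27.188 (1)] -/
theorem natCard_fixedPoints_torsion_eq_natCard_fixedPoints_hom (T : Over S) :
    Nat.card {x : T ⟶ A.torsion N // x ≫ torsionMap u N = x} =
      Nat.card {t : {t : T ⟶ A.X // t ^ N = 1} // (t : T ⟶ A.X) ≫ u = t} := by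
  haveI := A.mono_torsionι N
  have hpow : ∀ x : T ⟶ A.torsion N, (x ≫ A.torsionι N) ^ N = 1 := fun x => by
    rw [← comp_mulN, Category.assoc, torsionι_comp_mulN, MonObj.comp_one]
  have hlift : ∀ t : T ⟶ A.X, t ^ N = 1 → t ≫ A.mulN N = 1 := fun t ht => by rw [comp_mulN, ht]
  have hfix : ∀ x : T ⟶ A.torsion N, x ≫ torsionMap u N = x ↔ (x ≫ A.torsionι N) ≫ u = x ≫ A.torsionι N := fun x => by
    rw [Category.assoc, ← torsionMap_ι u N, ← Category.assoc]
    exact ⟨fun h => by rw [h], fun h => (cancel_mono (A.torsionι N)).mp h⟩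
  exact Nat.card_congr
    { toFun := fun x => ⟨⟨x.1 ≫ A.torsionι N, hpow x.1⟩, (hfix x.1).mp x.2⟩
      invFun := fun t => ⟨A.torsionLift t.1.1 (hlift t.1.1 t.1.2), (hfix _).mpr (by rw [torsionLift_ι]; exact t.2)⟩
      left_inv := fun x => Subtype.ext (A.torsion_hom_ext (by rw [torsionLift_ι]))
      right_inv := fun t => Subtype.ext (Subtype.ext (A.torsionLift_ι t.1.1 (hlift t.1.1 t.1.2))) }

/-- **Sections of `A[N]` fixed by `u[N]` ↔ `N`-torsion sections of `A` fixed by `u`** (`T = 𝟙_`; ★ `torsionSections N = {σ ∣ σ ^ N = 1}`).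
[cite: MumfordFogartyKirwan1994, Ch. 7 §2 Definition 7.1 (p. 129)] [cite: GortzWedhorn2023, Prop. 27.188 (1)] -/
theorem natCard_fixedPoints_torsion_eq_natCard_fixedPoints_torsionSections :
    Nat.card {x : 𝟙_ (Over S) ⟶ A.torsion N // x ≫ torsionMap u N = x} =
      Nat.card {σ : A.torsionSections N // (σ : A.Sections) ≫ u = σ} :=
  A.natCard_fixedPoints_torsion_eq_natCard_fixedPoints_hom u N (𝟙_ (Over S))

end AnyBase

/-! ## §2 Over a field: torsion sections = torsion points of the abelian variety -/

section Field

variable {Ω : Type u} [Field Ω] (A : AbelianSchemeOver (Spec (.of Ω))) [IsCommMonObj A.X] (u : A.X ⟶ A.X) [IsMonHom u] (N : ℕ)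

/-- **`N`-torsion sections of `A → Spec Ω` fixed by `u` ↔ `N`-torsion `Ω`-points of the abelian variety `A` fixed by `u`**:
`σ ↦ toUnit (specOver Ω Ω) ≫ σ` (precomposition with the isomorphism `specOver Ω Ω ≅ 𝟙_`, ★ `AffineGroupScheme.unitIsoSpecOver`, i.e. with `toUnit (specOver Ω Ω)`; it is multiplicative,
so it respects `(·)^N = 1`, and commutes with `(·) ≫ u`; the fixed-point condition on points is spelled with Mathlib's `IsMonHom.monoidHom u`,
`IsMonHom.monoidHom u _ P = P ≫ u`). [cite: MumfordFogartyKirwan1994, Ch. 7 §2 Definition 7.1 (p. 129)] -/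
theorem natCard_fixedPoints_torsionSections_eq_natCard_fixedPoints_torsionPoints :
    Nat.card {σ : A.torsionSections N // (σ : A.Sections) ≫ u = σ} =
      Nat.card {P : A.toAffine.toAbelianVariety.torsionPoints Ω (N : ℤ) //
        IsMonHom.monoidHom u (specOver Ω Ω) (P : A.toAffine.toAbelianVariety.Points Ω) =
          (P : A.toAffine.toAbelianVariety.Points Ω)} := by
  -- the isomorphism `e : 𝟙_ ≅ specOver Ω Ω` and the induced multiplicative bijection on points of `A`
  let e : 𝟙_ (Over (Spec (.of Ω))) ≅ specOver Ω Ω := AffineGroupScheme.unitIsoSpecOver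
  let ψ : A.Sections ≃* A.toAffine.toAbelianVariety.Points Ω :=
    { toFun := fun σ => e.inv ≫ σ
      invFun := fun P => e.hom ≫ P
      left_inv := fun σ => by simp
      right_inv := fun P => by simp
      map_mul' := fun σ τ => MonObj.comp_mul _ _ _ }
  refine Nat.card_congr
    { toFun := fun σ => ⟨⟨ψ σ.1, ?_⟩, ?_⟩
      invFun := fun P => ⟨⟨ψ.symm P.1, ?_⟩, ?_⟩
      left_inv := fun σ => Subtype.ext (Subtype.ext (ψ.symm_apply_apply _))
      right_inv := fun P => Subtype.ext (Subtype.ext (ψ.apply_symm_apply _)) }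
  · rw [AbelianVariety.mem_torsionPoints_iff, zpow_natCast, ← map_pow, A.torsionSections_pow N σ.1, _root_.map_one]
  · change (e.inv ≫ (σ.1 : A.Sections)) ≫ u = e.inv ≫ (σ.1 : A.Sections)
    rw [Category.assoc, σ.2]
  · rw [A.mem_torsionSections_iff, ← ψ.injective.eq_iff, map_pow, MulEquiv.apply_symm_apply, _root_.map_one, ← zpow_natCast]
    exact P.1.2
  · have h := P.2
    change (P.1 : A.toAffine.toAbelianVariety.Points Ω) ≫ u = (P.1 : A.toAffine.toAbelianVariety.Points Ω) at h
    change (e.hom ≫ (P.1 : A.toAffine.toAbelianVariety.Points Ω)) ≫ u = e.hom ≫ (P.1 : A.toAffine.toAbelianVariety.Points Ω)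
    rw [Category.assoc, h]

/-! ## §3 The bridge, assembled -/

/-- **TORSION SECTIONS FIXED BY `u[N]` = TORSION POINTS FIXED BY `u`** (HEAD of the bridge): for an abelian scheme `A` over a field `Ω`
with commutative group law, a homomorphism `u : A → A` and `N : ℕ`, the sections `x : 𝟙 ⟶ A[N]` with `x ≫ u[N] = x` are equinumerous with
the `N`-torsion `Ω`-points `P` of the abelian variety `A` with `u(P) = P` (§1 ∘ §2).  The left-hand side is the `hcount` currency of
★ `PDivisibleGroupBlockHeightTransport` §4, the right-hand side the currency of the A-lane (Tate∕Betti) count.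
[cite: MumfordFogartyKirwan1994, Ch. 7 §2 Definition 7.1 (p. 129)] [cite: GortzWedhorn2023, Prop. 27.188 (1)] -/
theorem natCard_fixedPoints_torsion_eq_natCard_fixedPoints_torsionPoints :
    Nat.card {x : 𝟙_ (Over (Spec (.of Ω))) ⟶ A.torsion N // x ≫ torsionMap u N = x} =
      Nat.card {P : A.toAffine.toAbelianVariety.torsionPoints Ω (N : ℤ) //
        IsMonHom.monoidHom u (specOver Ω Ω) (P : A.toAffine.toAbelianVariety.Points Ω) =
          (P : A.toAffine.toAbelianVariety.Points Ω)} := by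
  rw [A.natCard_fixedPoints_torsion_eq_natCard_fixedPoints_torsionSections u N,
    A.natCard_fixedPoints_torsionSections_eq_natCard_fixedPoints_torsionPoints u N]

end Field

/-! ## §4 The reading for the `w`-block: socket (S-H) from a count of fixed torsion POINTS at the generic geometric fibre -/

namespace RingAction

/-- **SOCKET (S-H) FROM FIXED TORSION POINTS.**  `𝒜` an abelian scheme over a local `Spec R₀` with a ring action `act : RingAction O 𝒜`,
`p ≠ 0`, `a : ℕ → O` a compatible idempotent family (`aₙ₊₁ ≡ aₙ`, `aₙ² ≡ aₙ (mod pⁿ)`), `gΩ : Spec Ω → Spec R₀` a geometric point with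
`(p : Ω) ≠ 0`, `gκ : Spec κ → Spec R₀` any field-valued point.  If for every `n` the number of `pⁿ`-torsion `Ω`-POINTS `P` of the abelian
variety `𝒜_Ω` with `ι_Ω(aₙ)(P) = P` is `p^{n h}`, then `rk_s (Fix ε_κ)_n = p^{n h}` on `Spec κ` for the block idempotent `ε_κ := β_κ(a)` of
`𝒜_κ[p^∞]` — ★ `hrank_specialFibre_of_natCard_fixedPoints` with its `hcount` rewritten through §3.
[cite: Tate1967, §2 (2.1) and (2.4)] [cite: MumfordFogartyKirwan1994, Ch. 7 §2 Definition 7.1 (p. 129)] -/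
theorem hrank_specialFibre_of_natCard_fixedPoints_torsionPoints {R₀ : Type u} [CommRing R₀] [IsLocalRing R₀]
    {𝒜 : AbelianSchemeOver (Spec (.of R₀))} [IsCommMonObj 𝒜.X] {p g : ℕ} (hp : p ≠ 0) (hg : 𝒜.IsOfRelDim g) {O : Type v} [CommRing O]
    (act : RingAction O 𝒜) (a : ℕ → O) (ha : ∀ n, a (n + 1) - a n ∈ Ideal.span {(p : O) ^ n})
    (ha2 : ∀ n, a n * a n - a n ∈ Ideal.span {(p : O) ^ n})
    {Ω : Type u} [Field Ω] [IsAlgClosed Ω] (gΩ : Spec (.of Ω) ⟶ Spec (.of R₀)) (hpΩ : (p : Ω) ≠ 0) [IsCommMonObj (𝒜.baseChange gΩ).X]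
    {κ : Type u} [Field κ] (gκ : Spec (.of κ) ⟶ Spec (.of R₀)) [IsCommMonObj (𝒜.baseChange gκ).X] {h : ℕ}
    (hcount : ∀ n, Nat.card {P : (𝒜.baseChange gΩ).toAffine.toAbelianVariety.torsionPoints Ω ((p ^ n : ℕ) : ℤ) //
      (haveI := (act.baseChange gΩ).isMonHom_i (a n); IsMonHom.monoidHom ((act.baseChange gΩ).i (a n)) (specOver Ω Ω))
        (P : (𝒜.baseChange gΩ).toAffine.toAbelianVariety.Points Ω) =
          (P : (𝒜.baseChange gΩ).toAffine.toAbelianVariety.Points Ω)} = p ^ (n * h))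
    (n : ℕ) (s : ↥(Spec (.of κ))) :
    (((isRingActionBT_pDivisibleGroupMap (act.baseChange gκ) hp (hg.baseChange gκ)).homOfCompatibleFamily a ha).fixLayer n).hom.finrank s =
      p ^ (n * h) := by
  refine hrank_specialFibre_of_natCard_fixedPoints hp hg act a ha ha2 gΩ hpΩ gκ (fun m => ?_) n s
  haveI := (act.baseChange gΩ).isMonHom_i (a m)
  rw [(𝒜.baseChange gΩ).natCard_fixedPoints_torsion_eq_natCard_fixedPoints_torsionPoints ((act.baseChange gΩ).i (a m)) (p ^ m)]
  exact hcount m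

end RingAction

end AbelianSchemeOver

end Literature.AlgebraicGeometry.AbelianSchemes

end
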